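import Summits.CriticalPhenomena.CardyFormulaZ2.Theorems.CardyMagicRigidityNestingRigidityBigLoopsExpMomentBK
import Summits.CriticalPhenomena.CardyFormulaZ2.Theorems.CardyMagicRigidityNestingRigidityTowerMomentUpperFamilies
import Summits.CriticalPhenomena.CardyFormulaZ2.Theorems.CardyMagicRigidityNestingRigidityGapTower
import HarnessLib

/-!
# A-priori polynomial UPPER bound on the tower moments, IV: bond-`ℤ²`
# (helper [B-up] of line `positive-cone-weight-doubling`, crux `NestingRigidity`)

Crux `Summit.CriticalPhenomena.CardyFormulaZ2.Theses.CardyMagicRigidity.NestingRigidity`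
(stmt-CriticalPhenomena-4835), line `positive-cone-weight-doubling`, registered helper
`towerMoment_upper_latticeEnsembles` ([B-up]).  This file proves the bond-`ℤ²` half for weights
`w ≥ 1` (`towerMoment_upper_zEns`): there are `C, c₀ > 0` with
`E_δ[w ^ N_0(r,1)] ≤ r ^ (-C)` for `0 < δ`, `c₀ δ ≤ r ≤ 1/2`.

Proof (thin cells + ONE BK–Reimer product): with the exponent `α` of the RSW annulus bound
`annulusOpenCrossing_half_le_holds`, fix an aspect ratio `K` with `w² (4/K)^α ≤ 1/2`
(`exists_aspect`) and take the `B ≤ 4(8K+1)² log₂(1/r)` dyadic cells of `…TowerMomentUpperCells`.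
* §1 (pointwise, `exists_patterns_zEns`) for a lattice configuration `ω`, the counter-clockwise loops
  of the tower sort into the cells (`TowerMomentUpper.exists_families`) and their rim clusters are
  pairwise disjoint open crossings of the cell annuli `A(c i; a i + δ, K a i - δ)`
  (`BigLoopsExp.mem_foldr_of_typeOne_families`, `…BigLoopsExpMomentBK`): `ω` lies in the joint
  disjoint occurrence `D₁ m₁` of the occupation pattern `m₁`; the clockwise ones do the same for
  `dualConfig ω` about the centres shifted by `-δ(1+i)/2` (`…_dualConfig_of_typeZero_families`),
  pattern `m₀`; and `N ≤ ∑ m₀ + ∑ m₁`;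
* §2 (`pattern_bound_zEns`) the pattern events are cylinder events of probability
  `≤ ∏ i, p ^ (m i)`, `p = (4/K)^α` (iterated Reimer `reimer_holds` through
  `BigLoopsExp.measureReal_foldr_ofFn_le_prod`, RSW `crossing_le_zEns`, self-duality
  `SSContinuity.measure_preimage_dualConfig_le`);
* §3 `E_δ[w^N] ≤ 2^B ≤ r^{-4(8K+1)²}` (`TowerMomentUpper.integral_pow_le_two_pow`,
  `TowerMomentUpper.two_pow_le_rpow_neg`).
-/

noncomputable section

open MeasureTheory Set Filter Metric
open scoped Real Topology BigOperators ENNReal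

namespace Summit.CriticalPhenomena.CardyFormulaZ2.Cruxes.NestingRigidity.PositiveConeWeightDoubling

open Literature.Probability.RandomPlanarGeometry Literature.Probability.Percolation
  Literature.Probability.LatticeModels
open Summit.CriticalPhenomena.CardyFormulaZ2.Cruxes.NestingRigidity.RingCloudTomography

namespace TowerMomentUpper

/-! ## §1 Pointwise: the two occupation patterns of a lattice configuration -/

/-- **The occupation patterns of the tower on bond-`ℤ²`.**  For a lattice configuration `ω` at mesh
`δ > 0`, cells `(c i, a i)` covering `r/2 < ‖z‖ < 2` with `K a i ≤ ‖c i‖` and `a i + 2δ ≤ K a i`, and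
a bound `M` on the number of loops meeting `B̄(0, 1)`: there are patterns `m₀, m₁ : Fin B → Fin (M+1)`
with `N_0(r,1) ≤ ∑ m₀ + ∑ m₁`, `ω` in the joint disjoint occurrence of `m₁ i` open crossings of
`A(c i; a i + δ, K a i - δ)` and `dualConfig ω` in that of `m₀ i` open crossings of the annuli about
`c i - δ(1+i)/2` (the counter-clockwise, resp. clockwise, loops of the tower sorted into the cells). -/
theorem exists_patterns_zEns {ω : BondConfig (Site 2)} (hω : ω ⊆ (zdGraph 2).edgeSet) {δ : ℝ}
    (hδ : 0 < δ) {r : ℝ} (hr : 0 < r) (hr2 : r < 2) {M : ℕ}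
    (hM : {u ∈ (zEns.X δ ω).loops | (u.range ∩ closedBall (0 : ℂ) 1).Nonempty}.Finite ∧
      {u ∈ (zEns.X δ ω).loops | (u.range ∩ closedBall (0 : ℂ) 1).Nonempty}.ncard ≤ M)
    {B : ℕ} {K : ℝ} (c : Fin B → ℂ) (a : Fin B → ℝ)
    (hcov : ∀ z : ℂ, r / 2 < ‖z‖ → ‖z‖ < 2 → ∃ i, dist z (c i) ≤ a i ∧ K * a i ≤ ‖c i‖)
    (hab : ∀ i, a i + 2 * δ ≤ K * a i) :
    ∃ m₀ m₁ : Fin B → Fin (M + 1),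
      towerCount (zEns.X δ ω) 0 r 1 ≤ ∑ i, (m₀ i : ℕ) + ∑ i, (m₁ i : ℕ) ∧
      dualConfig ω ∈ (List.ofFn fun i ↦ disjointOccurrencePow
        (annulusOpenCrossing (c i - δ * (1 + Complex.I) / 2) δ (a i + δ) (K * a i - δ))
          (m₀ i : ℕ)).foldr disjointOccurrence univ ∧
      ω ∈ (List.ofFn fun i ↦ disjointOccurrencePow
        (annulusOpenCrossing (c i) δ (a i + δ) (K * a i - δ)) (m₁ i : ℕ)).foldr
          disjointOccurrence univ := by
  -- the typed towers
  set S : Fin 2 → Set (UnbasedLoop ℂ) := fun t ↦ {u ∈ (bondLoopConfig δ 0 ω).F t |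
    closedBall (0 : ℂ) r ⊆ {z | u.wind z ≠ 0} ∧ u.range ⊆ ball (0 : ℂ) 1} with hS
  have hSsub : ∀ t, S t ⊆ {u ∈ (zEns.X δ ω).loops | (u.range ∩ closedBall (0 : ℂ) 1).Nonempty} := by
    rintro t u ⟨hu, hwind, hrange⟩
    refine ⟨?_, ?_⟩
    · change u ∈ (bondLoopConfig δ 0 ω).loops
      rw [LoopConfig.mem_loops_iff]
      fin_cases t
      · exact Or.inl hu
      · exact Or.inr hu
    · obtain ⟨z, hz, -, hz1⟩ := exists_mem_range_norm u hwind hrange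
      exact ⟨z, hz, mem_closedBall_zero_iff.2 hz1.le⟩
  have hSfin : ∀ t, (S t).Finite := fun t ↦ hM.1.subset (hSsub t)
  have hSM : ∀ t, (S t).ncard ≤ M := fun t ↦ (Set.ncard_le_ncard (hSsub t) hM.1).trans hM.2
  have htower : ∀ t, ∀ u ∈ S t, closedBall (0 : ℂ) r ⊆ {z | u.wind z ≠ 0} ∧ u.range ⊆ ball (0 : ℂ) 1 :=
    fun t u hu ↦ hu.2
  -- the tower count splits by type
  have hcount : towerCount (zEns.X δ ω) 0 r 1 ≤ (S 0).ncard + (S 1).ncard := by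
    have heq : {u ∈ (zEns.X δ ω).loops |
        closedBall (0 : ℂ) r ⊆ {z | u.wind z ≠ 0} ∧ u.range ⊆ ball (0 : ℂ) 1} = S 0 ∪ S 1 := by
      ext u
      simp only [hS, Set.mem_setOf_eq, Set.mem_union]
      change (u ∈ (bondLoopConfig δ 0 ω).loops ∧ _) ↔ _
      rw [LoopConfig.mem_loops_iff]
      tauto
    unfold towerCount
    rw [heq]
    exact Set.ncard_union_le _ _
  -- sort both typed towers into the cells
  obtain ⟨T₀, m₀, hT₀S, hT₀fin, hT₀disj, hmeet₀, hm₀, hsum₀⟩ :=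
    exists_families (hSfin 0) (hSM 0) hr.le hr2 (htower 0) c a hcov
  obtain ⟨T₁, m₁, hT₁S, hT₁fin, hT₁disj, hmeet₁, hm₁, hsum₁⟩ :=
    exists_families (hSfin 1) (hSM 1) hr.le hr2 (htower 1) c a hcov
  refine ⟨m₀, m₁, ?_, ?_, ?_⟩
  · rw [hsum₀, hsum₁]; exact hcount
  · exact BigLoopsExp.mem_foldr_dualConfig_of_typeZero_families hω hδ (b := fun i ↦ K * a i) hab c T₀
      (fun i u hu ↦ (hT₀S i hu).1) hT₀fin hT₀disj hmeet₀ (fun i ↦ (m₀ i : ℕ)) fun i ↦ (hm₀ i).le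
  · exact BigLoopsExp.mem_foldr_of_typeOne_families hω hδ (b := fun i ↦ K * a i) hab c T₁
      (fun i u hu ↦ (hT₁S i hu).1) hT₁fin hT₁disj hmeet₁ (fun i ↦ (m₁ i : ℕ)) fun i ↦ (hm₁ i).le

/-! ## §2 The pattern events: cylinder events, one BK–Reimer product, RSW -/

/-- **One BK–Reimer product over all cells (bond-`ℤ²`).**  The joint disjoint occurrence of `k i`
open crossings of the annuli `A(x i; a i, b i)` is a cylinder event of probability
`≤ ∏ i, p ^ (k i)` whenever every single crossing has probability `≤ p` (Reimer's inequality
`reimer_holds`, iterated by `BigLoopsExp.measureReal_foldr_ofFn_le_prod` over a common finite set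
of determining edges). -/
theorem pattern_bound_zEns {δ : ℝ} (hδ : 0 < δ) {B : ℕ} (x : Fin B → ℂ) (a b : Fin B → ℝ) {p : ℝ}
    (hp : ∀ i, (bondPercolation (zdGraph 2) half).real (annulusOpenCrossing (x i) δ (a i) (b i)) ≤ p)
    (k : Fin B → ℕ) :
    MeasurableSet ((List.ofFn fun i ↦ disjointOccurrencePow
      (annulusOpenCrossing (x i) δ (a i) (b i)) (k i)).foldr disjointOccurrence univ) ∧
    (bondPercolation (zdGraph 2) half).real ((List.ofFn fun i ↦ disjointOccurrencePow
      (annulusOpenCrossing (x i) δ (a i) (b i)) (k i)).foldr disjointOccurrence univ) ≤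
      ∏ i, p ^ (k i) := by
  classical
  -- a common finite determining set of edges
  set G : Fin B → Finset (Sym2 (Site 2)) := fun i ↦
    (finite_setOf_dist_meshPoint_le hδ (x i) (b i + 2 * δ)).toFinset.sym2 with hG
  set F : Finset (Sym2 (Site 2)) := Finset.univ.sup G with hF
  have hAF : ∀ i, DeterminedBy (annulusOpenCrossing (x i) δ (a i) (b i)) ↑F := fun i ↦
    (determinedBy_annulusOpenCrossing hδ (x i) (a i) (b i)).mono
      (Finset.coe_subset.2 (Finset.le_sup (f := G) (Finset.mem_univ i)))
  have hA : ∀ i, IsUpperSet (annulusOpenCrossing (x i) δ (a i) (b i)) := fun i ↦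
    isUpperSet_annulusOpenCrossing _ _ _ _
  have hdet := BigLoopsExp.determinedBy_foldr (BigLoopsExp.determinedBy_of_mem_ofFn hAF k)
  refine ⟨hdet.measurableSet_of_finset, ?_⟩
  have hBK : ∀ A' B' : Set (Set (Sym2 (Site 2))), IsUpperSet A' → IsUpperSet B' →
      DeterminedBy A' ↑F → DeterminedBy B' ↑F →
      (bondPercolation (zdGraph 2) half).real (A' □ B') ≤
        (bondPercolation (zdGraph 2) half).real A' * (bondPercolation (zdGraph 2) half).real B' :=
    fun A' B' _ _ hA' hB' ↦ reimer_holds (zdGraph 2) half ⟨F, hA'⟩ ⟨F, hB'⟩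
  refine (BigLoopsExp.measureReal_foldr_ofFn_le_prod (bondPercolation (zdGraph 2) half) hBK _ k
    hA hAF).trans ?_
  exact Finset.prod_le_prod (fun i _ ↦ pow_nonneg measureReal_nonneg _) fun i _ ↦
    pow_le_pow_left₀ measureReal_nonneg (hp i) _

/-- **RSW in a cell of aspect ratio `K ≥ 8`**: with the exponent `α` and threshold `c₁` of
`annulusOpenCrossing_half_le_holds`, the open crossing of `A(x; a + δ, K a - δ)` has probability
`≤ (4/K)^α` as soon as `c₁ δ ≤ a` and `2 δ ≤ a`. -/
theorem crossing_le_zEns {α c₁ : ℝ} (hα : 0 < α)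
    (hbd : ∀ (x : ℂ) (δ r R : ℝ), 0 < δ → c₁ * δ ≤ r → 2 * r ≤ R →
      (bondPercolation (zdGraph 2) half).real (annulusOpenCrossing x δ r R) ≤ (r / R) ^ α)
    {K : ℝ} (hK : 8 ≤ K) {δ a : ℝ} (hδ : 0 < δ) (hc₁ : c₁ * δ ≤ a) (h2 : 2 * δ ≤ a) (x : ℂ) :
    (bondPercolation (zdGraph 2) half).real (annulusOpenCrossing x δ (a + δ) (K * a - δ)) ≤
      (4 / K) ^ α := by
  have ha : 0 < a := by linarith
  have hKa : 8 * a ≤ K * a := mul_le_mul_of_nonneg_right hK ha.le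
  have h1 := hbd x δ (a + δ) (K * a - δ) hδ (by linarith) (by linarith)
  refine h1.trans (Real.rpow_le_rpow (div_nonneg (by linarith) (by linarith)) ?_ hα.le)
  rw [div_le_div_iff₀ (by linarith) (by linarith)]
  nlinarith

/-- **The aspect ratio.**  For `w ≥ 1` and `α > 0` there is an integer `K ≥ 8` with
`w² (4/K)^α ≤ 1/2`. -/
theorem exists_aspect {w α : ℝ} (hw : 1 ≤ w) (hα : 0 < α) :
    ∃ K : ℕ, 8 ≤ K ∧ w ^ 2 * (4 / K) ^ α ≤ 1 / 2 := by
  set t : ℝ := (2 * w ^ 2) ^ (1 / α) with ht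
  have ht0 : 0 < t := by positivity
  refine ⟨max 8 ⌈4 * t⌉₊, le_max_left _ _, ?_⟩
  have hK : 4 * t ≤ ((max 8 ⌈4 * t⌉₊ : ℕ) : ℝ) :=
    (Nat.le_ceil _).trans (by exact_mod_cast le_max_right _ _)
  have hKpos : (0 : ℝ) < ((max 8 ⌈4 * t⌉₊ : ℕ) : ℝ) := by linarith
  have h1 : (4 : ℝ) / ((max 8 ⌈4 * t⌉₊ : ℕ) : ℝ) ≤ t⁻¹ := by
    rw [div_le_iff₀ hKpos, inv_mul_eq_div, le_div_iff₀ ht0]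
    linarith
  have h2 : ((4 : ℝ) / ((max 8 ⌈4 * t⌉₊ : ℕ) : ℝ)) ^ α ≤ t⁻¹ ^ α :=
    Real.rpow_le_rpow (by positivity) h1 hα.le
  have h3 : t⁻¹ ^ α = (2 * w ^ 2)⁻¹ := by
    rw [Real.inv_rpow ht0.le, ht, one_div, Real.rpow_inv_rpow (by positivity) hα.ne']
  rw [h3] at h2
  calc w ^ 2 * ((4 : ℝ) / ((max 8 ⌈4 * t⌉₊ : ℕ) : ℝ)) ^ α ≤ w ^ 2 * (2 * w ^ 2)⁻¹ :=
        mul_le_mul_of_nonneg_left h2 (by positivity)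
    _ = 1 / 2 := by field_simp

/-! ## §3 The bound on bond-`ℤ²` -/

/-- **A-priori polynomial upper bound on the tower moments of bond-`ℤ²`, weights `w ≥ 1`.**  There
are `C` and `c₀ > 0` such that `E_δ[w ^ N_0(r,1)] ≤ r ^ (-C)` for all `0 < δ`, `c₀ δ ≤ r ≤ 1/2`
(`C = 4(8K+1)²` with the aspect ratio `K` of `exists_aspect`). -/
theorem towerMoment_le_rpow_zEns {w : ℝ} (hw : 1 ≤ w) : ∃ C c₀ : ℝ, 0 < c₀ ∧
    ∀ r δ : ℝ, 0 < δ → c₀ * δ ≤ r → r ≤ 1 / 2 → zEns.towerMoment w δ r ≤ r ^ (-C) := by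
  haveI := isProbabilityMeasure_of_mem zEns_mem
  obtain ⟨α, c₁, hα, hc₁, hbd⟩ := annulusOpenCrossing_half_le_holds
  obtain ⟨K, hK8, hKw⟩ := exists_aspect hw hα
  have hK1 : 1 ≤ K := by omega
  have hK8' : (8 : ℝ) ≤ K := by exact_mod_cast hK8
  have hK0 : (0 : ℝ) < K := by linarith
  refine ⟨4 * (8 * K + 1) ^ 2, 8 * K * (c₁ + 2), by positivity, fun r δ hδ hδr hr2 ↦ ?_⟩
  have hr : 0 < r := lt_of_lt_of_le (by positivity) hδr
  obtain ⟨B, c, a, hB, ha, hcov⟩ := exists_cells hK1 hr hr2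
  -- mesh conditions in every cell
  have hmesh : ∀ i, c₁ * δ ≤ a i ∧ 2 * δ ≤ a i := fun i ↦ by
    have h1 := (ha i).1
    have h2 : (c₁ + 2) * δ ≤ r / (8 * K) := by
      rw [le_div_iff₀ (by positivity)]; linarith
    have hδ0 := hδ.le
    constructor <;> nlinarith
  have hab : ∀ i, a i + 2 * δ ≤ (K : ℝ) * a i := fun i ↦ by
    have := (hmesh i).2
    have ha0 : 0 ≤ a i := by linarith
    nlinarith [mul_le_mul_of_nonneg_right hK8' ha0]
  obtain ⟨M, hM⟩ := FirstMoment.exists_ncard_loops_meeting_le zEns zEns_mem hδ 1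
  -- the single-cell crossing probability
  have hp : ∀ (x : ℂ) (i : Fin B), (bondPercolation (zdGraph 2) half).real
      (annulusOpenCrossing x δ (a i + δ) (K * a i - δ)) ≤ ((4 : ℝ) / K) ^ α := fun x i ↦
    crossing_le_zEns hα hbd hK8' hδ (hmesh i).1 (hmesh i).2 x
  -- the two families of pattern events
  set D₁ : (Fin B → Fin (M + 1)) → Set (BondConfig (Site 2)) := fun m ↦
    (List.ofFn fun i ↦ disjointOccurrencePow (annulusOpenCrossing (c i) δ (a i + δ) (K * a i - δ))
      (m i : ℕ)).foldr disjointOccurrence univ with hD₁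
  set D₀ : (Fin B → Fin (M + 1)) → Set (BondConfig (Site 2)) := fun m ↦ dualConfig ⁻¹'
    (List.ofFn fun i ↦ disjointOccurrencePow
      (annulusOpenCrossing (c i - δ * (1 + Complex.I) / 2) δ (a i + δ) (K * a i - δ))
        (m i : ℕ)).foldr disjointOccurrence univ with hD₀
  have h₁ : ∀ m, MeasurableSet (D₁ m) ∧ zEns.P.real (D₁ m) ≤ ∏ i, (((4 : ℝ) / K) ^ α) ^ (m i : ℕ) :=
    fun m ↦ pattern_bound_zEns hδ c (fun i ↦ a i + δ) (fun i ↦ K * a i - δ) (fun i ↦ hp (c i) i)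
      fun i ↦ (m i : ℕ)
  have h₀ : ∀ m, MeasurableSet (D₀ m) ∧ zEns.P.real (D₀ m) ≤ ∏ i, (((4 : ℝ) / K) ^ α) ^ (m i : ℕ) := by
    intro m
    obtain ⟨hmeas, hle⟩ := pattern_bound_zEns hδ (fun i ↦ c i - δ * (1 + Complex.I) / 2)
      (fun i ↦ a i + δ) (fun i ↦ K * a i - δ) (fun i ↦ hp _ i) fun i ↦ (m i : ℕ)
    exact ⟨measurableSet_preimage measurable_dualConfig hmeas,
      (ENNReal.toReal_mono (measure_ne_top _ _)
        (SSContinuity.measure_preimage_dualConfig_le _)).trans hle⟩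
  have key := integral_pow_le_two_pow zEns.P D₀ D₁ (fun m ↦ (h₀ m).1) (fun m ↦ (h₁ m).1)
    (p := ((4 : ℝ) / K) ^ α) (by positivity) hw hKw (fun m ↦ (h₀ m).2) (fun m ↦ (h₁ m).2)
    (fun ω ↦ towerCount (zEns.X δ ω) 0 r 1) ?_
  · calc zEns.towerMoment w δ r = ∫ ω, w ^ towerCount (zEns.X δ ω) 0 r 1 ∂zEns.P := rfl
      _ ≤ 2 ^ B := key
      _ ≤ r ^ (-(4 * (8 * (K : ℝ) + 1) ^ 2)) := two_pow_le_rpow_neg hr hB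
  · change ∀ᵐ ω ∂(bondPercolation (zdGraph 2) half), _
    filter_upwards [ae_subset_edgeSet (zdGraph 2) half] with ω hω
    exact exists_patterns_zEns hω hδ hr (by linarith) (hM ω) c a hcov hab

end TowerMomentUpper

/-! ## Anchor: [B-up] on bond-`ℤ²` for weights `w ≥ 1` -/

/-- **Anchor (helper toward [B-up] `towerMoment_upper_latticeEnsembles`): the a-priori polynomial
upper bound on the positively weighted tower moments of bond-`ℤ²`**, weights `w ≥ 1`: for all small
`r` and then all small meshes, `E_δ[w ^ N_0(r,1)] ≤ r ^ (-C)`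
(`TowerMomentUpper.towerMoment_le_rpow_zEns`, `r₀ = 1/2`). -/
theorem towerMoment_upper_zEns : ∀ w : ℝ, 1 ≤ w → ∃ C r₀ : ℝ, 0 < r₀ ∧ ∀ r ∈ Set.Ioo (0 : ℝ) r₀, ∀ᶠ δ in 𝓝[>] (0 : ℝ), zEns.towerMoment w δ r ≤ r ^ (-C) := by
  intro w hw
  obtain ⟨C, c₀, hc₀, h⟩ := TowerMomentUpper.towerMoment_le_rpow_zEns hw
  refine ⟨C, 1 / 2, by norm_num, fun r hr ↦ ?_⟩
  filter_upwards [TowerMomentUpper.eventually_mesh_le hc₀ hr.1] with δ hδ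
  exact h r δ hδ.1 hδ.2 hr.2.le

end Summit.CriticalPhenomena.CardyFormulaZ2.Cruxes.NestingRigidity.PositiveConeWeightDoubling

end
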